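import Literature.MathematicalPhysics.QuantumFieldTheory.Balaban1983to89.B6Prop26ChainGeneric
import Literature.MathematicalPhysics.QuantumFieldTheory.Balaban1983to89.B6RandomWalkHom

/-!
# `Balaban1983to89.B6Prop26RightChainGeneric` — T. Bałaban, *Propagators and renormalization transformations for lattice gauge theories. II*,
# Commun. Math. Phys. **96** (1984) 223–250 [Balaban1984PropagatorsII], Prop. 2.6 (2.136) p. 247, THE THIRD ENTRY `|(G∇*J)(x)| ≤ O(1)·Lʲη·e^{−δ₃d}|J|`:
# the random-walk chain of Proposition 2.2/2.6 RUN FROM THE LEFT (the resolvent identity `G = G₀ + RᵀG` of (2.91)/(2.141) for a RIGHT factor),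
# generic over the block geometry — the first brick of the transposed route for the one entry of (2.136) that is not of left-factor form

statement-level skeleton of published theorems with citation tags; proofs where landed; nothing here is a claim about the Yang–Mills mass gap

PDF held: `paper:balaban1984-cmp96-propagators-rt-ii` (journal page = PDF page + 222); p. 247 [PDF 25] (Prop. 2.6 (2.136), (2.141)), p. 234 [PDF 12]
((2.64)–(2.67), *"The similar inequalities hold for a derivative of G′λ …"*, Prop. 2.2 with its third entry `|(G′∇*λ)(x)|`), p. 239 [PDF 17] ((2.91)) re-read
this generation on the ×2 renders `b2b-balaban-ref1/pages/1984-cmp96-propagators-rt-II/…-p012/p017/p025-x2.png`.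

CITATION HEADER (lean-in-tree rule) — WHAT IS REPRODUCED.  Phase-2 file of the `lit-balaban` typed skeleton (HOME `run/shared/lean/pub/lit-balaban/`), seat
**p38 gen 31** (free target under protocol G.5-34(d); the programme «(2.136)₃ by the transposed walk» announced in HOME/STATUS.md 2026-08-23T16:53:34Z and
agreed with p22 g23 (who takes the transposed line 3 and the right two-scale legs), cc the B6 fold owner r03); SKELETON rows **B6.Prop2.6** × B6.Eq2.141 ×
B6.Eq2.64–2.66 (cells only; decls of record untouched).
WHY A SEPARATE CHAIN.  Print obtains all four sup entries of (2.136) by *"reasoning in the same way as in the proof of Proposition 2.2"* from the walk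
(2.141) `G = G₀(I − R)⁻¹ = Σ_n G₀Rⁿ`.  For a LEFT factor `D` (`D = 1, ∇, Δ`: the tree's `…B6Prop26ChainGeneric.prop26_entry_of_291With`, p38's
`…B6Prop26PairKLevelAssemblyV1` / `…GradKLevelV1` / `…LapKLevelV1`) `D·G = (D·G₀)·ΣRⁿ` needs only the first legs `D·h_□G_□h_□`.  For the RIGHT factor `∇*`
of the third entry the factor hits the LAST leg `K_{□,□′}G_{□′}h_{□′}∇*` of (2.141), whose sup norm is NOT uniformly bounded (it contains `∇G_□∇*`; print's
own mixed entry (2.138) carries a Hölder norm of `J`).  The sup entry `|(G∇*J)(x)|` therefore goes — exactly as the tree's two-level Proposition 2.2 file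
`…B6Prop22AdjTwoLevelBox` does for (2.67)₃ — through the TRANSPOSED resolvent identity: `G` and `G₀` are symmetric, so (2.91) `Δ_aG₀ = I − R` also gives
`G₀Δ_a = I − R̃` with `R̃ = Rᵀ = Σ_{□,□′} h_{□′}G_{□′}K̃_{□,□′}` (every product of (2.92)–(2.93) reversed), hence `G = G₀ + R̃G` and, for any right factor
`D′`, `G·D′ = G₀·D′ + R̃·(G·D′)` — a fixed-point equation with the small operator on the LEFT.  THIS FILE proves the GENERIC part of that route over an
arbitrary block geometry `g` (blocks `blk : X → 𝔅`, the tree's `HasMajorant` of `…B6RandomWalk`), Lemma 2.1 entering only through (2.61) with an arbitrary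
constant `c` (`…B6Lemma21Repaired.Ineq261With`) and the triangle inequality (2.54):
* §1 `sup_le_of_hasMajorant` (an operator with majorant `K` and row sums `Σ_b K(a,b) ≤ κ` maps `|v| ≤ B` to `|Tv| ≤ κB`), `rowSum_exp_le` ((2.61) at the
  full rate from the rate `αδ`), `sup_pow_le`;
* §2 the LEFT chain with the prefactor carried at the INPUT block: **`majorant_leftIterW`** (`R̃ⁿT₀` has majorant `A(θc)ⁿe^{−(1−α)δd(a,b)}P(b)` when `T₀` has
  `A·e^{−δd(a,b)}·P(b)` and `R̃` has `θe^{−δd}` — induction with `R̃` in front, (2.54) and ONE use of (2.61) per step, no (2.63) and no symmetry of `d`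
  needed), `majorant_leftPartialSumW` (geometric series, `θc < 1`), **`majorant_of_leftFixedPointW`** (any `T` with `T = T₀ + R̃T` on a finite lattice has
  majorant `A(1 − θc)⁻¹e^{−(1−α)δd(a,b)}P(b)`; the telescope is pv10's `…B6RandomWalkHom.leftFixedPoint_telescope`, the remainder dies by `sup_pow_le` and
  `…B6RandomWalk.exists_opBound`).  These are the `With`-constant forms (suffix `W`, arbitrary (2.61)-constant `c`, rate loss `α`, neither (2.63) nor the
  symmetry of `d`) of pv10's `…B6RandomWalkHom.majorant_leftPartialSum` / `majorant_of_leftFixedPoint` (which are stated with Lemma 2.1's `c₁(α)`, (2.63),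
  `d` symmetric and rate loss `2α`) — the k-level pipeline runs on `…B6Lemma21Repaired.Ineq261With` (r03's `prop26_2136_kLevel_final_le`);
* §3 the algebra of the right entry: `leftFixedPoint_of_291T` (`Δ_aG = 1`, `G₀Δ_a = 1 − R̃` ⟹ `G = G₀ + R̃G`), `rightEntry_fixedPoint` (⟹ `G·D′ = G₀D′ +
  R̃·(G·D′)`), **`rightEntry_of_291T`** (the third-entry analogue of `prop26_entry_of_291With`);
* §4 the localisation counts with indicators (the mirror of pv09's `majorant_G0_of_2133` / `ineq2135_of_2134_291`, stated with the tree's `ind`):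
  `hasMajorant_sum_indOut` (terms with output indicators `1_{U_i}(a)` of overlap `N` sum to `N·K`), `hasMajorant_sum₂_ind` (double sums with `1_{U_{i′}}(a)·1_{U_i}(b)`
  sum to `N²·K`);
* §5 **`prop26_rightEntry_of_2133T_2134T`** — THE GENERIC MIRROR GLUING: boxes `𝒟` with sets `U_□` of overlap `N`; per-cube right legs
  `h_□G_□h_□D′` with majorant `1_{U_□}(a)·A·e^{−δd(a,b)}·P(b)`; per-pair reversed kernels `h_{□′}G_{□′}K̃_{□,□′}` with majorant `1_{U_{□′}}(a)·1_{U_□}(b)·θ₀e^{−δd}`;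
  `G₀ = Σ h_□G_□h_□`, `R̃ = Σ_{□,□′} h_{□′}G_{□′}K̃_{□,□′}`, `G₀Δ_a = 1 − R̃`, `Δ_aG = 1`; then under `N²θ₀c < 1` the right entry `G·D′` has the majorant
  `N·A·(1 − N²θ₀c)⁻¹·e^{−(1−α)δd(a,b)}·P(b)` (prefactor at the INPUT block; moving it to the output block is the level-gap step of the torus, done downstream).
THEOREMS ONLY; no `def`, no `def … : Prop`, no new hypothesis-shaped fact; standard axioms.

HONEST SCOPE / DIVERGENCES.  (1) Print does not spell the argument for the right-factor entries out (*"The similar inequalities hold …"*, *"Reasoning in the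
same way …"*); the transposed resolvent identity is OUR reading of the only route compatible with the printed norms (the tree's precedent for (2.67)₃:
`…B6Prop22AdjTwoLevelBox`, `…B6Prop22AdjMultiLevelTorus`); it is recorded in HOME/GAPS.md.  (2) Nothing model-specific is proved here: the reversed kernels
`K̃_{□,□′}`, their (2.134)-type bounds (the transposed commutator legs, the transposed line 3 — p22's `B6Line3CubeTransposeV1` —, the off-diagonal gap), the
identity `G₀Δ_a = 1 − R̃` for the genuine V1 operators (p02's ring-generic `…B6Eq291Generator.eq291` in the opposite ring) and the level-gap transport of the
prefactor are the next files of the programme.  (3) Constants: `A(1 − θc)⁻¹` (one factor `c` fewer than the left chain, because the `n = 0` term needs no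
(2.61)); `θ = N²θ₀` after gluing.  Integer/abstract geometry; nothing on d = 4 or the continuum; NOT summit progress.  Unit `lit-balaban-p38` (gen 31),
2026-08-23.
-/

namespace Literature.MathematicalPhysics.QuantumFieldTheory.Balaban1983to89.B6Prop26RightChainGeneric

open Finset
open B6RandomWalk (HasMajorant BlockSupp hasMajorant_mono hasMajorant_mul hasMajorant_add hasMajorant_sum blockPiece sum_blockPiece blockSupp_blockPiece
  exists_opBound Triangle254)
open B6Lemma21Repaired (Ineq261With)
open B6Prop26Gluing (mulOp ind ind_nonneg ind_le_one ind_of_mem ind_of_not_mem hasMajorant_finsetSum)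

noncomputable section

variable {g : B6.Geometry} {X : Type}

/-! ## §1  Sup bounds from majorants -/

/-- **AN OPERATOR WITH A MAJORANT AND BOUNDED ROW SUMS IS BOUNDED ON `ℓ^∞`**: if `T` has the block majorant `K` and `Σ_b K(a,b) ≤ κ` for every `a`, then
`|v| ≤ B` implies `|Tv| ≤ κB` (decompose `v = Σ_{y′} Δ(y′)v`). [cite: Balaban1984PropagatorsII, (2.52) p.232 («Σ_{y∈𝔅} Δ(y) = I»), (2.61) p.234] -/
theorem sup_le_of_hasMajorant [Fintype X] [DecidableEq X] (blk : X → g.Site) {T : Module.End ℝ (X → ℝ)} {K : g.Site → g.Site → ℝ} {κ : ℝ}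
    (hT : HasMajorant blk T K) (hrow : ∀ a, ∑ b : g.Site, K a b ≤ κ) (v : X → ℝ) {B : ℝ} (hB : 0 ≤ B)
    (hv : ∀ x, |v x| ≤ B) (x : X) : |T v x| ≤ κ * B := by
  classical
  letI := g.fin
  have hdec : T v x = ∑ y' : g.Site, T (blockPiece blk y' v) x := by
    conv_lhs => rw [← sum_blockPiece blk v, map_sum]
    rw [Finset.sum_apply]
  rw [hdec]
  refine (Finset.abs_sum_le_sum_abs _ _).trans ?_
  have hpiece : ∀ y' : g.Site, |T (blockPiece blk y' v) x| ≤ K (blk x) y' * B := fun y' =>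
    hT y' _ B (blockSupp_blockPiece blk v y' B hB fun x' _ => hv x') x
  calc ∑ y' : g.Site, |T (blockPiece blk y' v) x| ≤ ∑ y' : g.Site, K (blk x) y' * B := Finset.sum_le_sum fun y' _ => hpiece y'
    _ = (∑ y' : g.Site, K (blk x) y') * B := by rw [Finset.sum_mul]
    _ ≤ κ * B := mul_le_mul_of_nonneg_right (hrow (blk x)) hB

/-- the row sums of `θe^{−δd}` from (2.61) at the rate `αδ ≤ δ` (`0 ≤ α ≤ 1`, `δ ≥ 0`, `d ≥ 0`): `Σ_b θe^{−δd(a,b)} ≤ θc`.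
[cite: Balaban1984PropagatorsII, Lemma 2.1 (2.61) p.234] -/
theorem rowSum_exp_le {c δ α θ : ℝ} (hθ : 0 ≤ θ) (hα1 : α ≤ 1) (hδ : 0 ≤ δ) (hdnn : ∀ a b : g.Site, 0 ≤ g.dist a b)
    (h261 : Ineq261With c g δ α) (a : g.Site) :
    (letI := g.fin; ∑ b : g.Site, θ * Real.exp (-(δ * g.dist a b))) ≤ θ * c := by
  letI := g.fin
  rw [← Finset.mul_sum]
  refine mul_le_mul_of_nonneg_left (le_trans (Finset.sum_le_sum fun b _ => ?_) (h261 a)) hθ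
  exact Real.exp_le_exp.mpr (neg_le_neg (mul_le_mul_of_nonneg_right (by nlinarith [hdnn a b]) (hdnn a b)))

/-- **`‖R̃ᴺv‖_∞ ≤ (θc)ᴺ‖v‖_∞`** for an operator with majorant `θe^{−δd}` under (2.61). [cite: Balaban1984PropagatorsII, (2.64)–(2.65) p.234, (2.61) p.234] -/
theorem sup_pow_le [Fintype X] [DecidableEq X] (blk : X → g.Site) {c δ α θ : ℝ} (hθ : 0 ≤ θ) (hc : 0 ≤ c) (hα1 : α ≤ 1) (hδ : 0 ≤ δ)
    (hdnn : ∀ a b : g.Site, 0 ≤ g.dist a b) (h261 : Ineq261With c g δ α) {R : Module.End ℝ (X → ℝ)}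
    (hR : HasMajorant blk R (fun a b => θ * Real.exp (-(δ * g.dist a b)))) (N : ℕ) (v : X → ℝ) {B : ℝ} (hB : 0 ≤ B) (hv : ∀ x, |v x| ≤ B) :
    ∀ x, |(R ^ N) v x| ≤ (θ * c) ^ N * B := by
  induction N with
  | zero => intro x; simpa using hv x
  | succ N ih =>
      intro x
      rw [pow_succ', Module.End.mul_apply, pow_succ', mul_assoc]
      exact sup_le_of_hasMajorant blk hR (rowSum_exp_le hθ hα1 hδ hdnn h261) _ (mul_nonneg (pow_nonneg (mul_nonneg hθ hc) N) hB) ih x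

/-! ## §2  The chain run from the left, prefactor at the input block -/

/-- **THE LEFT CHAIN `R̃ⁿT₀`**: if `T₀` has majorant `A·e^{−δd(a,b)}·P(b)` (prefactor at the INPUT block) and `R̃` has majorant `θe^{−δd}`, then `R̃ⁿT₀` has
majorant `A(θc)ⁿ·e^{−(1−α)δd(a,b)}·P(b)` — by induction with `R̃` in front: `Σ_{y″} θe^{−δd(a,y″)}·e^{−(1−α)δd(y″,b)} ≤ θc·e^{−(1−α)δd(a,b)}` from (2.54) and
(2.61) (the sum runs over the SECOND argument of `d`, as printed; no symmetry of `d` is used). [cite: Balaban1984PropagatorsII, (2.64)–(2.66) p.234, (2.54) p.233, (2.61) p.234] -/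
theorem majorant_leftIterW (blk : X → g.Site) (c δ α θ A : ℝ) (P : g.Site → ℝ) (hA : 0 ≤ A) (hP : ∀ y, 0 ≤ P y) (hθ : 0 ≤ θ) (hc : 0 ≤ c)
    (hα0 : 0 ≤ α) (hα1 : α ≤ 1) (hδ : 0 ≤ δ) (htri : Triangle254 g) (hdnn : ∀ a b : g.Site, 0 ≤ g.dist a b) (h261 : Ineq261With c g δ α)
    {T0 R : Module.End ℝ (X → ℝ)}
    (hT0 : HasMajorant blk T0 (fun a b => A * Real.exp (-(δ * g.dist a b)) * P b))
    (hR : HasMajorant blk R (fun a b => θ * Real.exp (-(δ * g.dist a b)))) (n : ℕ) :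
    HasMajorant blk (R ^ n * T0) (fun a b => A * (θ * c) ^ n * Real.exp (-((1 - α) * δ * g.dist a b)) * P b) := by
  letI := g.fin
  induction n with
  | zero =>
      rw [pow_zero, one_mul]
      refine hasMajorant_mono blk hT0 fun a b => ?_
      rw [pow_zero, mul_one]
      refine mul_le_mul_of_nonneg_right (mul_le_mul_of_nonneg_left (Real.exp_le_exp.mpr (neg_le_neg ?_)) hA) (hP b)
      have := hdnn a b
      nlinarith [mul_nonneg (mul_nonneg hα0 hδ) this]
  | succ n ih =>
      rw [pow_succ', mul_assoc]
      have hK₂ : ∀ a b : g.Site, 0 ≤ A * (θ * c) ^ n * Real.exp (-((1 - α) * δ * g.dist a b)) * P b := fun a b =>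
        mul_nonneg (mul_nonneg (mul_nonneg hA (pow_nonneg (mul_nonneg hθ hc) n)) (Real.exp_nonneg _)) (hP b)
      refine hasMajorant_mono blk (hasMajorant_mul blk hR ih hK₂) fun a b => ?_
      -- `Σ_{y″} θe^{−δd(a,y″)}·A(θc)ⁿe^{−(1−α)δd(y″,b)}P(b) ≤ A(θc)^{n+1}e^{−(1−α)δd(a,b)}P(b)`
      have hterm : ∀ y'' : g.Site,
          θ * Real.exp (-(δ * g.dist a y'')) * (A * (θ * c) ^ n * Real.exp (-((1 - α) * δ * g.dist y'' b)) * P b) ≤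
            A * (θ * c) ^ n * θ * P b * Real.exp (-((1 - α) * δ * g.dist a b)) * Real.exp (-(α * δ * g.dist a y'')) := by
        intro y''
        have hexp : Real.exp (-(δ * g.dist a y'')) * Real.exp (-((1 - α) * δ * g.dist y'' b)) ≤
            Real.exp (-((1 - α) * δ * g.dist a b)) * Real.exp (-(α * δ * g.dist a y'')) := by
          rw [← Real.exp_add, ← Real.exp_add]
          refine Real.exp_le_exp.mpr ?_
          -- RHS − LHS of the exponents = `(1−α)δ·(d(a,y″) + d(y″,b) − d(a,b)) ≥ 0` by (2.54)
          have key : (1 - α) * δ * g.dist a b ≤ (1 - α) * δ * (g.dist a y'' + g.dist y'' b) :=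
            mul_le_mul_of_nonneg_left (htri a y'' b) (mul_nonneg (sub_nonneg.2 hα1) hδ)
          nlinarith [key]
        have h0 : 0 ≤ A * (θ * c) ^ n * θ * P b := mul_nonneg (mul_nonneg (mul_nonneg hA (pow_nonneg (mul_nonneg hθ hc) n)) hθ) (hP b)
        calc θ * Real.exp (-(δ * g.dist a y'')) * (A * (θ * c) ^ n * Real.exp (-((1 - α) * δ * g.dist y'' b)) * P b)
            = A * (θ * c) ^ n * θ * P b * (Real.exp (-(δ * g.dist a y'')) * Real.exp (-((1 - α) * δ * g.dist y'' b))) := by ring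
          _ ≤ A * (θ * c) ^ n * θ * P b * (Real.exp (-((1 - α) * δ * g.dist a b)) * Real.exp (-(α * δ * g.dist a y''))) :=
              mul_le_mul_of_nonneg_left hexp h0
          _ = _ := by ring
      have h0 : 0 ≤ A * (θ * c) ^ n * θ * P b * Real.exp (-((1 - α) * δ * g.dist a b)) :=
        mul_nonneg (mul_nonneg (mul_nonneg (mul_nonneg hA (pow_nonneg (mul_nonneg hθ hc) n)) hθ) (hP b)) (Real.exp_nonneg _)
      calc ∑ y'' : g.Site, θ * Real.exp (-(δ * g.dist a y'')) * (A * (θ * c) ^ n * Real.exp (-((1 - α) * δ * g.dist y'' b)) * P b)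
          ≤ ∑ y'' : g.Site, A * (θ * c) ^ n * θ * P b * Real.exp (-((1 - α) * δ * g.dist a b)) * Real.exp (-(α * δ * g.dist a y'')) :=
            Finset.sum_le_sum fun y'' _ => hterm y''
        _ = A * (θ * c) ^ n * θ * P b * Real.exp (-((1 - α) * δ * g.dist a b)) * ∑ y'' : g.Site, Real.exp (-(α * δ * g.dist a y'')) := by
            rw [Finset.mul_sum]
        _ ≤ A * (θ * c) ^ n * θ * P b * Real.exp (-((1 - α) * δ * g.dist a b)) * c := mul_le_mul_of_nonneg_left (h261 a) h0
        _ = A * (θ * c) ^ (n + 1) * Real.exp (-((1 - α) * δ * g.dist a b)) * P b := by ring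

/-- the partial sums `Σ_{n<N} R̃ⁿT₀` of the left chain have majorant `A(1 − θc)⁻¹·e^{−(1−α)δd(a,b)}·P(b)` uniformly in `N`, under `θc < 1`.
[cite: Balaban1984PropagatorsII, (2.66) p.234, (2.50) p.232] -/
theorem majorant_leftPartialSumW (blk : X → g.Site) (c δ α θ A : ℝ) (P : g.Site → ℝ) (hA : 0 ≤ A) (hP : ∀ y, 0 ≤ P y) (hθ : 0 ≤ θ) (hc : 0 ≤ c)
    (hα0 : 0 ≤ α) (hα1 : α ≤ 1) (hδ : 0 ≤ δ) (htri : Triangle254 g) (hdnn : ∀ a b : g.Site, 0 ≤ g.dist a b) (h261 : Ineq261With c g δ α)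
    (hsmall : θ * c < 1) {T0 R : Module.End ℝ (X → ℝ)}
    (hT0 : HasMajorant blk T0 (fun a b => A * Real.exp (-(δ * g.dist a b)) * P b))
    (hR : HasMajorant blk R (fun a b => θ * Real.exp (-(δ * g.dist a b)))) (N : ℕ) :
    HasMajorant blk (∑ n ∈ Finset.range N, R ^ n * T0) (fun a b => A * (1 - θ * c)⁻¹ * Real.exp (-((1 - α) * δ * g.dist a b)) * P b) := by
  set q : ℝ := θ * c with hq
  have hq0 : 0 ≤ q := mul_nonneg hθ hc
  have hterm : ∀ n, HasMajorant blk (R ^ n * T0) (fun a b => A * q ^ n * Real.exp (-((1 - α) * δ * g.dist a b)) * P b) := fun n =>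
    majorant_leftIterW blk c δ α θ A P hA hP hθ hc hα0 hα1 hδ htri hdnn h261 hT0 hR n
  refine hasMajorant_mono blk (hasMajorant_sum blk (fun n => R ^ n * T0) _ hterm N) fun a b => ?_
  have hgeom : ∑ n ∈ Finset.range N, q ^ n ≤ (1 - q)⁻¹ :=
    sum_le_hasSum (Finset.range N) (fun n _ => pow_nonneg hq0 n) (hasSum_geometric_of_lt_one hq0 hsmall)
  have hC : 0 ≤ A * Real.exp (-((1 - α) * δ * g.dist a b)) * P b := mul_nonneg (mul_nonneg hA (Real.exp_nonneg _)) (hP b)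
  calc ∑ n ∈ Finset.range N, A * q ^ n * Real.exp (-((1 - α) * δ * g.dist a b)) * P b
      = A * Real.exp (-((1 - α) * δ * g.dist a b)) * P b * ∑ n ∈ Finset.range N, q ^ n := by
        rw [Finset.mul_sum]; refine Finset.sum_congr rfl fun n _ => ?_; ring
    _ ≤ A * Real.exp (-((1 - α) * δ * g.dist a b)) * P b * (1 - q)⁻¹ := mul_le_mul_of_nonneg_left hgeom hC
    _ = _ := by ring

/-- **THE LEFT CHAIN FOR THE OPERATOR ITSELF**: on a finite lattice, any `T` with `T = T₀ + R̃T`, `T₀` of majorant `A·e^{−δd(a,b)}·P(b)` and `R̃` of majorant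
`θe^{−δd}` with `θc < 1` has majorant `A(1 − θc)⁻¹·e^{−(1−α)δd(a,b)}·P(b)` — the remainder `R̃ᴺT` of the telescope dies as `N → ∞` (`‖R̃ᴺ‖_∞ ≤ (θc)ᴺ`).  The
mirror image of `…B6Prop23Chain.majorant_of_fixedPoint_266W`. [cite: Balaban1984PropagatorsII, Prop. 2.2 (2.66)–(2.67) p.234 («The similar inequalities hold …»), (2.141) p.247] -/
theorem majorant_of_leftFixedPointW [Fintype X] [DecidableEq X] (blk : X → g.Site) (c δ α θ A : ℝ) (P : g.Site → ℝ) (hA : 0 ≤ A) (hP : ∀ y, 0 ≤ P y)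
    (hθ : 0 ≤ θ) (hc : 0 ≤ c) (hα0 : 0 ≤ α) (hα1 : α ≤ 1) (hδ : 0 ≤ δ) (htri : Triangle254 g) (hdnn : ∀ a b : g.Site, 0 ≤ g.dist a b)
    (h261 : Ineq261With c g δ α) (hsmall : θ * c < 1) {T T0 R : Module.End ℝ (X → ℝ)}
    (hT0 : HasMajorant blk T0 (fun a b => A * Real.exp (-(δ * g.dist a b)) * P b))
    (hR : HasMajorant blk R (fun a b => θ * Real.exp (-(δ * g.dist a b)))) (hfix : T = T0 + R * T) :
    HasMajorant blk T (fun a b => A * (1 - θ * c)⁻¹ * Real.exp (-((1 - α) * δ * g.dist a b)) * P b) := by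
  intro y' μ B hμ x
  obtain ⟨E, hE, hEb⟩ := exists_opBound T
  set q : ℝ := θ * c with hq
  have hq0 : 0 ≤ q := mul_nonneg hθ hc
  set C : ℝ := A * (1 - q)⁻¹ * Real.exp (-((1 - α) * δ * g.dist (blk x) y')) * P y' * B with hC
  have hμB : ∀ z, |μ z| ≤ B := fun z => by
    by_cases hz : blk z = y'
    · exact hμ.bound z hz
    · rw [hμ.off z hz, abs_zero]; exact hμ.nonneg
  have hTμ : ∀ z, |T μ z| ≤ E * B := hEb μ B hμ.nonneg hμB
  have hN : ∀ N : ℕ, |T μ x| ≤ C + q ^ N * (E * B) := by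
    intro N
    have hS := majorant_leftPartialSumW blk c δ α θ A P hA hP hθ hc hα0 hα1 hδ htri hdnn h261 hsmall hT0 hR N y' μ B hμ x
    have hrem : |(R ^ N * T) μ x| ≤ q ^ N * (E * B) := by
      rw [Module.End.mul_apply]
      exact sup_pow_le blk hθ hc hα1 hδ hdnn h261 hR N (T μ) (mul_nonneg hE hμ.nonneg) hTμ x
    have hsplit : T μ x = (∑ n ∈ Finset.range N, R ^ n * T0) μ x + (R ^ N * T) μ x := by
      conv_lhs => rw [B6RandomWalkHom.leftFixedPoint_telescope hfix N]
      rfl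
    rw [hsplit]
    refine (abs_add_le _ _).trans ?_
    have h1 : |(∑ n ∈ Finset.range N, R ^ n * T0) μ x| ≤ C := by simpa [hC, hq] using hS
    linarith [hrem, h1]
  have hlim : Filter.Tendsto (fun N : ℕ => C + q ^ N * (E * B)) Filter.atTop (nhds (C + 0 * (E * B))) :=
    ((tendsto_pow_atTop_nhds_zero_of_lt_one hq0 hsmall).mul_const (E * B)).const_add C
  rw [zero_mul, add_zero] at hlim
  have := ge_of_tendsto' hlim hN
  simpa [hC, hq] using this

/-! ## §3  The algebra of a right entry: `G·D′ = G₀D′ + R̃·(G·D′)` from `Δ_aG = 1` and `G₀Δ_a = 1 − R̃` -/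

/-- **THE LEFT FIXED-POINT EQUATION FROM THE TRANSPOSED (2.91)**: `Δ_aG = 1` and `G₀Δ_a = 1 − R̃` give `G = G₀ + R̃G`.
[cite: Balaban1984PropagatorsII, (2.91) p.239, (2.141) p.247 («G = G₀(I − R)⁻¹»)] -/
theorem leftFixedPoint_of_291T {G G0 Δa Rt : Module.End ℝ (X → ℝ)} (hinv : Δa * G = 1) (h291T : G0 * Δa = 1 - Rt) : G = G0 + Rt * G := by
  have h : (G0 * Δa) * G = (1 - Rt) * G := by rw [h291T]
  rw [mul_assoc, hinv, mul_one, sub_mul, one_mul] at h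
  rw [h, sub_add_cancel]

/-- … and for any RIGHT factor `D′`: `G·D′ = G₀D′ + R̃·(G·D′)`. [cite: Balaban1984PropagatorsII, (2.141) p.247, Prop. 2.6 (2.136)₃ p.247] -/
theorem rightEntry_fixedPoint {G G0 Δa Rt : Module.End ℝ (X → ℝ)} (hinv : Δa * G = 1) (h291T : G0 * Δa = 1 - Rt) (D' : Module.End ℝ (X → ℝ)) :
    G * D' = G0 * D' + Rt * (G * D') := by
  conv_lhs => rw [leftFixedPoint_of_291T hinv h291T]
  rw [add_mul, mul_assoc]

/-- **A RIGHT ENTRY OF (2.136) FROM THE TRANSPOSED WALK** (the third-entry analogue of `…B6Prop26ChainGeneric.prop26_entry_of_291With`): `Δ_aG = 1`,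
`G₀Δ_a = 1 − R̃`, `G₀D′` of majorant `A·e^{−δd(a,b)}·P(b)`, `R̃` of majorant `θe^{−δd}`, `θc < 1` ⟹ `G·D′` has majorant `A(1 − θc)⁻¹e^{−(1−α)δd(a,b)}P(b)`.
[cite: Balaban1984PropagatorsII, Prop. 2.6 (2.136) p.247, (2.141) p.247, (2.91) p.239, Lemma 2.1 (2.61) p.234] -/
theorem rightEntry_of_291T [Fintype X] [DecidableEq X] (blk : X → g.Site) (c δ α θ A : ℝ) (P : g.Site → ℝ) (hA : 0 ≤ A) (hP : ∀ y, 0 ≤ P y)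
    (hθ : 0 ≤ θ) (hc : 0 ≤ c) (hα0 : 0 ≤ α) (hα1 : α ≤ 1) (hδ : 0 ≤ δ) (htri : Triangle254 g) (hdnn : ∀ a b : g.Site, 0 ≤ g.dist a b)
    (h261 : Ineq261With c g δ α) (hsmall : θ * c < 1) {G G0 Δa Rt D' : Module.End ℝ (X → ℝ)} (hinv : Δa * G = 1) (h291T : G0 * Δa = 1 - Rt)
    (hG0D : HasMajorant blk (G0 * D') (fun a b => A * Real.exp (-(δ * g.dist a b)) * P b))
    (hR : HasMajorant blk Rt (fun a b => θ * Real.exp (-(δ * g.dist a b)))) :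
    HasMajorant blk (G * D') (fun a b => A * (1 - θ * c)⁻¹ * Real.exp (-((1 - α) * δ * g.dist a b)) * P b) :=
  majorant_of_leftFixedPointW blk c δ α θ A P hA hP hθ hc hα0 hα1 hδ htri hdnn h261 hsmall hG0D hR (rightEntry_fixedPoint hinv h291T D')

/-! ## §4  Localisation counts with indicators (the mirror of (2.133) ⟹ `G₀`-bound and of (2.134) ⟹ (2.135)) -/

section Counting

variable {ι : Type} (𝒟 : Finset ι) (U : ι → Set g.Site)

open Classical in
/-- the overlap count: `Σ_{i∈𝒟} 1_{U_i}(a) ≤ N` when at most `N` of the sets `U_i` contain `a`. [cite: Balaban1984PropagatorsII, (2.133)/(2.135) p.247 (the finite overlap of the cubes □̃)] -/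
theorem sum_ind_le {N : ℕ} (hover : ∀ a : g.Site, (𝒟.filter fun i => a ∈ U i).card ≤ N) (a : g.Site) : ∑ i ∈ 𝒟, ind (U i) a ≤ (N : ℝ) := by
  classical
  have h : ∑ i ∈ 𝒟, ind (U i) a = ((𝒟.filter fun i => a ∈ U i).card : ℝ) := by
    rw [Finset.card_eq_sum_ones, Nat.cast_sum, Finset.sum_filter]
    refine Finset.sum_congr rfl fun i _ => ?_
    by_cases hi : a ∈ U i
    · rw [if_pos hi, ind_of_mem hi, Nat.cast_one]
    · rw [if_neg hi, ind_of_not_mem hi]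
  rw [h]
  exact_mod_cast hover a

open Classical in
/-- **OUTPUT-LOCALISED TERMS OF OVERLAP `N` SUM TO `N·K`**: `HasMajorant (T_i) (1_{U_i}(a)·K(a,b))` for `i ∈ 𝒟`, `K ≥ 0` ⟹ `HasMajorant (Σ_{i∈𝒟} T_i) (N·K)`.
[cite: Balaban1984PropagatorsII, (2.133) ⟹ (2.141) p.247, (2.49) p.232] -/
theorem hasMajorant_sum_indOut (blk : X → g.Site) {N : ℕ} (hover : ∀ a : g.Site, (𝒟.filter fun i => a ∈ U i).card ≤ N)
    {T : ι → Module.End ℝ (X → ℝ)} {K : g.Site → g.Site → ℝ} (hK : ∀ a b, 0 ≤ K a b)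
    (hT : ∀ i ∈ 𝒟, HasMajorant blk (T i) (fun a b => ind (U i) a * K a b)) :
    HasMajorant blk (∑ i ∈ 𝒟, T i) (fun a b => (N : ℝ) * K a b) := by
  refine hasMajorant_mono blk (hasMajorant_finsetSum blk 𝒟 _ _ hT) fun a b => ?_
  rw [← Finset.sum_mul]
  exact mul_le_mul_of_nonneg_right (sum_ind_le 𝒟 U hover a) (hK a b)

open Classical in
/-- **DOUBLY LOCALISED PAIR TERMS OF OVERLAP `N` SUM TO `N²·K`** (the shape of (2.134) ⟹ (2.135) for the reversed products `h_{□′}G_{□′}K̃_{□,□′}`, whose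
outputs lie in `U_{□′}` and whose inputs lie in `U_□`): `HasMajorant (T_{i,i′}) (1_{U_{i′}}(a)·1_{U_i}(b)·K(a,b))` ⟹ `HasMajorant (Σ_iΣ_{i′} T_{i,i′}) (N²·K)`.
[cite: Balaban1984PropagatorsII, (2.134)–(2.135) p.247] -/
theorem hasMajorant_sum₂_ind (blk : X → g.Site) {N : ℕ} (hover : ∀ a : g.Site, (𝒟.filter fun i => a ∈ U i).card ≤ N)
    {T : ι → ι → Module.End ℝ (X → ℝ)} {K : g.Site → g.Site → ℝ} (hK : ∀ a b, 0 ≤ K a b)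
    (hT : ∀ i ∈ 𝒟, ∀ i' ∈ 𝒟, HasMajorant blk (T i i') (fun a b => ind (U i') a * ind (U i) b * K a b)) :
    HasMajorant blk (∑ i ∈ 𝒟, ∑ i' ∈ 𝒟, T i i') (fun a b => ((N : ℝ) * N) * K a b) := by
  have hrow : ∀ i ∈ 𝒟, HasMajorant blk (∑ i' ∈ 𝒟, T i i') (fun a b => ind (U i) b * ((N : ℝ) * K a b)) := by
    intro i hi
    have h1 : ∀ i' ∈ 𝒟, HasMajorant blk (T i i') (fun a b => ind (U i') a * (ind (U i) b * K a b)) := fun i' hi' =>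
      hasMajorant_mono blk (hT i hi i' hi') fun a b => (mul_assoc _ _ _).le
    refine hasMajorant_mono blk (hasMajorant_sum_indOut 𝒟 U blk hover (fun a b => mul_nonneg (ind_nonneg _ _) (hK a b)) h1) fun a b => ?_
    exact (mul_left_comm _ _ _).le
  have h2 : ∀ i ∈ 𝒟, HasMajorant blk (∑ i' ∈ 𝒟, T i i') (fun a b => ind (U i) b * ((N : ℝ) * K a b)) := hrow
  refine hasMajorant_mono blk (hasMajorant_finsetSum blk 𝒟 _ _ h2) fun a b => ?_
  rw [← Finset.sum_mul]
  have := sum_ind_le 𝒟 U hover b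
  calc (∑ i ∈ 𝒟, ind (U i) b) * ((N : ℝ) * K a b) ≤ (N : ℝ) * ((N : ℝ) * K a b) :=
        mul_le_mul_of_nonneg_right this (mul_nonneg (Nat.cast_nonneg _) (hK a b))
    _ = _ := by ring

end Counting

/-! ## §5  The generic mirror gluing: (2.133)ᵀ-type right legs and (2.134)ᵀ-type reversed kernels ⟹ the right entry -/

open Classical in
/-- **PROPOSITION 2.6, A RIGHT ENTRY, GENERIC MIRROR GLUING.**  Boxes `𝒟` with localisation sets `U_□` of overlap `≤ N`; `G₀ = Σ_□ h_□G_□h_□` and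
`R̃ = Σ_□Σ_{□′} X̃_{□,□′}` with `G₀Δ_a = 1 − R̃` (the transposed (2.91)) and `Δ_aG = 1`; per cube the RIGHT LEG `h_□G_□h_□·D′` has majorant
`1_{U_□}(a)·A·e^{−δd(a,b)}·P(b)` (the transposed (2.133)) and per pair the reversed kernel `X̃_{□,□′}` has majorant `1_{U_{□′}}(a)·1_{U_□}(b)·θ₀e^{−δd(a,b)}` (the
transposed (2.134)); then, under `N²θ₀·c < 1`, the right entry `G·D′` has majorant `N·A·(1 − N²θ₀c)⁻¹·e^{−(1−α)δd(a,b)}·P(b)`.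
[cite: Balaban1984PropagatorsII, Prop. 2.6 (2.133)–(2.136) p.247, (2.141) p.247, (2.91)–(2.93) p.239, Lemma 2.1 (2.61) p.234] -/
theorem prop26_rightEntry_of_2133T_2134T [Fintype X] [DecidableEq X] (blk : X → g.Site) {ι : Type} (𝒟 : Finset ι) (U : ι → Set g.Site) {N : ℕ}
    (hover : ∀ a : g.Site, (𝒟.filter fun i => a ∈ U i).card ≤ N) (c δ α θ₀ A : ℝ) (P : g.Site → ℝ) (hA : 0 ≤ A) (hP : ∀ y, 0 ≤ P y)
    (hθ₀ : 0 ≤ θ₀) (hc : 0 ≤ c) (hα0 : 0 ≤ α) (hα1 : α ≤ 1) (hδ : 0 ≤ δ) (htri : Triangle254 g) (hdnn : ∀ a b : g.Site, 0 ≤ g.dist a b)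
    (h261 : Ineq261With c g δ α) (hsmall : ((N : ℝ) * N * θ₀) * c < 1)
    {G Δa D' : Module.End ℝ (X → ℝ)} {h : ι → X → ℝ} {Gl : ι → Module.End ℝ (X → ℝ)} {Xt : ι → ι → Module.End ℝ (X → ℝ)}
    (hinv : Δa * G = 1) (h291T : (∑ i ∈ 𝒟, mulOp (h i) * Gl i * mulOp (h i)) * Δa = 1 - ∑ i ∈ 𝒟, ∑ i' ∈ 𝒟, Xt i i')
    (h2133T : ∀ i ∈ 𝒟, HasMajorant blk (mulOp (h i) * Gl i * mulOp (h i) * D') (fun a b => ind (U i) a * (A * Real.exp (-(δ * g.dist a b)) * P b)))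
    (h2134T : ∀ i ∈ 𝒟, ∀ i' ∈ 𝒟, HasMajorant blk (Xt i i') (fun a b => ind (U i') a * ind (U i) b * (θ₀ * Real.exp (-(δ * g.dist a b))))) :
    HasMajorant blk (G * D')
      (fun a b => (N : ℝ) * A * (1 - (N : ℝ) * N * θ₀ * c)⁻¹ * Real.exp (-((1 - α) * δ * g.dist a b)) * P b) := by
  -- the right legs sum to `G₀D′` with majorant `N·A·e^{−δd}·P(b)`
  have hG0D : HasMajorant blk ((∑ i ∈ 𝒟, mulOp (h i) * Gl i * mulOp (h i)) * D') (fun a b => (N : ℝ) * A * Real.exp (-(δ * g.dist a b)) * P b) := by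
    rw [Finset.sum_mul]
    refine hasMajorant_mono blk (hasMajorant_sum_indOut 𝒟 U blk hover
      (fun a b => mul_nonneg (mul_nonneg hA (Real.exp_nonneg _)) (hP b)) h2133T) fun a b => ?_
    exact (by ring : (N : ℝ) * (A * Real.exp (-(δ * g.dist a b)) * P b) = (N : ℝ) * A * Real.exp (-(δ * g.dist a b)) * P b).le
  -- the reversed kernels sum to `R̃` with majorant `N²θ₀·e^{−δd}`
  have hR : HasMajorant blk (∑ i ∈ 𝒟, ∑ i' ∈ 𝒟, Xt i i') (fun a b => (N : ℝ) * N * θ₀ * Real.exp (-(δ * g.dist a b))) := by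
    refine hasMajorant_mono blk (hasMajorant_sum₂_ind 𝒟 U blk hover (fun a b => mul_nonneg hθ₀ (Real.exp_nonneg _)) h2134T) fun a b => ?_
    exact (by ring : (N : ℝ) * N * (θ₀ * Real.exp (-(δ * g.dist a b))) = (N : ℝ) * N * θ₀ * Real.exp (-(δ * g.dist a b))).le
  exact rightEntry_of_291T blk c δ α ((N : ℝ) * N * θ₀) ((N : ℝ) * A) P (mul_nonneg (Nat.cast_nonneg _) hA) hP
    (mul_nonneg (mul_nonneg (Nat.cast_nonneg _) (Nat.cast_nonneg _)) hθ₀) hc hα0 hα1 hδ htri hdnn h261 hsmall hinv h291T hG0D hR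

end

end Literature.MathematicalPhysics.QuantumFieldTheory.Balaban1983to89.B6Prop26RightChainGeneric
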